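import Summits.NavierStokesRegularity.NavierStokesRegularity.Theorems.PalasekTowerBreakdownEpisodeBaseTMechanismFreeRun
import Literature.Analysis.FluidPDE.AxisymmetricEuler

/-!
# Line `free_run_faces` (v5 of the `arnold_ring_door` lineage) — EpisodeBaseT (stmt-NavierStokesRegularity-20303)
# from ONE free Navier–Stokes run of an EXPLICIT cut-off curl datum (Gaussian-cored coaxial rings with swirl):
# static datum lemma ⊕ certified-trajectory stub, composed through the landed door BY NAME

Seat `ns-idea-12` g2 (D-0145 ideator, lens «oqh»), 2026-08-28 (v5.1: §1b proves the support clause of stub A). Crux of record: `Theses.PalasekTowerBreakdown.EpisodeBaseT`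
(route `PalasekTowerBreakdown`, deciding binder h₁ of `closes`; DORMANT-REVIEW). FILES ONLY from this seat: the skeleton of
record on 20303 is `splitface` (ns-idea-2 g6); this file is a published line, not a registry entry (KEY-NS #87/#93).
WHAT THIS IS NOT: not Navier–Stokes evidence — no run or certificate is exhibited; `EpisodeBaseT` appears only as the
conclusion of the sorry-free composition `episodeBaseT_from_line` of the two stubs. No summit is proved by a line.

WHY v5 (rule (4): diagnose → vary). Line v4 `arnold_ring_door` = «explicit Gaussian reference with residual ≤ θ·Y₁A₀/M₀ over
the tuned window» ⊕ «uniform viscous-coherence door for every such design». Its decider ran: R17 (j302511) killed the sterile /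
thin-swirl tranche by the FLOOR, R18 (j302918, ADDENDUM-R18 2f32dc7b2599b698) returned «INHABITANT-CANDIDATE»: at the design point
PX-R30-sw0.45, fiat core laws μ = (0.913, 1.48, 0.508, 0.109), the tuned FACES ARE MET with slack θ = 0.10 (margins: datum +0.060,
cap +0.789, speed +0.040, gradient +1.83, loop +4.99) but the residual quotient is Q(0.10) = 6.975, and θ·Q(θ) ≡ 0.6975 with the
faces failing before θ = 0.25 ⇒ Q ≥ 2.8 at every feasible slack; E5(iii): the bare-ring m = 1 dipole correction buys ≤ 20 %, the
residual is CORE-INTERIOR and grows ×8 as the cores thin (design note `Lines/arnold_ring_door_design.md` 521329c120919153).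
DIAGNOSIS: «closed-form reference with small residual» is the wrong currency for a ν = 1 thinning-core episode — any fiat core
law leaves an O(1)-relative interior residual — while the door theorem
`Theorems.palasekTowerBreakdown_episodeBaseT_of_mechanism_freeRun` consumes a FREE RUN WITH FACES, not a reference.
VARIATION (this file): keep the explicit datum class (it is what the faces were met with), drop the reference trajectory and
the shadowing theorem, and ask for the free run itself:
* `DatumStaticT` (stub A, M/L, provable analysis): for every ring datum in the regime, the cut-off potential
  `potD d = χ_{ρ₀} · (NewtonPotential(ω_ref) + SwirlPotential)` is `C^∞` with `tsupport ⊆ B̄(0, ρ₀)`, and its curl (the datum)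
  is axisymmetric WITH swirl — so the witness class is explicit and outside the sterile swirl-free stratum (STERILE-DOOR).
* `FreeRunFacesT` (stub B, the decider; XL as a certificate): for SOME datum `d` in the regime, `curl (potD d)` has speed
  `< Y₀` and its free run (`ν = 1`, zero force) exists classically with finite energy on `[1, τ₁]`, stays under the cap
  `(5/3)Y₁ − η` and shows the three tuned level-`1` faces with a margin `η > 0` inside `‖x‖ ≤ ρ₀` — verbatim the dynamic
  binders of the door. LEVER (new on 20303): profile-and-certify ONE axisymmetric-with-swirl trajectory (validated numerics:
  a finite-window parabolic enclosure of one solution, van den Berg–Breden–Lessard–van Veen arXiv:1902.00384 (CAP periodic orbits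
  of Navier–Stokes), Chen–Hou arXiv:2210.07191 (a-posteriori stability with rigorous numerics), Arioli–Koch / Zgliczyński-type
  rigorous integration of dissipative PDE) instead of a uniform shadowing THEOREM for a class (v4 stub 2 = the Gallay–Šverák
  open question) — a finite, decidable object; its why-it-might-fail is below.
COMPOSITION: `episodeBaseT_from_line : DatumStaticT → FreeRunFacesT → EpisodeBaseT` is the door applied to `W := curl (potD d)`
with the static binders discharged by `Germ.contDiff_curl_top`, `Germ.isDivFree_curl`, `Germ.tsupport_curl_subset`.

DECIDER R19 (pre-registered words; instrument BEFORE any certificate work; kit licence requested from director-ns 08:19:32Z):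
a NON-rigorous axisymmetric DNS (ψ–ω_θ–Γ formulation, ν = 1) on `[1, τ₁]` of the R18 datum (the t′ = 0 rings of PX-R30-sw0.45,
d₀ = 26.0275, cut off at ρ₀; executor's engine; two grids): «R19 FACES-MET-DNS (cap + three faces, every margin ≥ 2× the
two-grid difference)» ⇒ stub B is worth a certificate programme (next price: a validated enclosure, XL) | «R19 FACES-MISSED-DNS:
<face>, margin» ⇒ this line is DEAD for the PX-R30 datum, and with it the head-on swirling-pair episode unless R18's other
faces-met points (μ_a = 0.95/1.0/1.05 share the datum — they differ only in fiat laws, so ONE run decides all four) — i.e. dead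
outright | «R19 INCONCLUSIVE: <numerical reason>» ⇒ one re-run at most. Budget estimate 4–8 core-h (stretched (r, z) grid ≈ 1–2 M
cells, implicit diffusion, ≈ 2·10⁴ steps). MODEL numerics decide nothing in the kernel; a FACES-MET-DNS word is not an inhabitant.

WHY IT MIGHT FAIL (front page): (i) the reference kinematics met the speed face with margin +0.040·Y₁ only; the TRUE run diffuses
and deforms the cores differently from the fiat laws (that is exactly what Q ≈ 7 says), so the true speed at τ₁ can land on either
side of (1+θ)Y₁ — R19 decides; (ii) compactly supported swirl is centrifugally (Rayleigh) unstable on the outer flank of each core;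
over 169.85 strain times at the design Reynolds number the m = 0 axisymmetric instability may shed the swirl and with it the
gradient face; (iii) even after FACES-MET-DNS, a kernel certificate of a 170-strain-time nonlinear parabolic trajectory needs a
dissipativity-aware enclosure (naive Gronwall inflation e^{A·T} is hopeless) — research-grade CAP, honest size XL.
NOVELTY vs the lines on 20303: `arnold_ring_door` v1–v4 (reference + shadowing door; v5 drops both), `splitface` (ns-idea-2: faces
split across runs + far-field superposition; here ONE axisymmetric run carries all faces, no superposition step), LEAD `straindoor`
(`RawCertificateAt tuned` = the kernel certificate of the host's own germ; here the certified object is an explicit swirling ring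
pair found by the N1/R18 design search, and the door is the landed binder-form theorem). Corpses avoided: no S-N1 frozen-dead member
(those are swirl-free / 2-D / sterile classes; this datum has a swirl floor), STERILE-DOOR closed class excluded by `¬ HasNoSwirl`.
BARRIERS: technique_class = explicit-datum design ⊕ computer-assisted enclosure. `Literature/Barriers/NavierStokesRegularity/*`
(scaling-critical / energy-class obstructions, KNSS-type Liouville rigidity for bounded ancient axisymmetric solutions) do not
quantify over a finite-window statement about one smooth compactly supported datum; the relevant obstruction is practical (iii).

References: S. Palasek, arXiv:2605.13827 §4 [cite: Palasek2026ElementaryModel, §4]; J. B. van den Berg, M. Breden, J.-P. Lessard,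
L. van Veen, arXiv:1902.00384 (J. Nonlinear Sci. 31 (2021) 41); J. Chen, T. Y. Hou, arXiv:2210.07191 / arXiv:2305.05660;
T. Gallay, V. Šverák, arXiv:2301.01092 p. 4 (why v4's door was an open question); [cite: KNSS2009, §1];
[cite: MajdaBertozziCUP2002, §1.1 (1.11)].
-/

noncomputable section

set_option linter.dupNamespace false

namespace Summit.NavierStokesRegularity.NavierStokesRegularity.Cruxes.EpisodeBaseT.FreeRunFaces

open Set MeasureTheory Filter Topology Function Metric
open scoped ENNReal ContDiff NNReal
open Literature.Analysis.FluidPDE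
open Summit.NavierStokesRegularity.FluidComputer
open Summit.NavierStokesRegularity.FluidComputer.PalasekTowerClayBridge
open Summit.NavierStokesRegularity.NavierStokesRegularity.Theses

/-! ## §0 Tuned numbers (abbreviations only) -/

/-- Datum speed bound `Y₀(tuned)`. -/
abbrev Y0 : ℝ := TowerRates.tuned.Y 0

/-! ## §1 The explicit datum class: cut-off curl potential of Gaussian-cored coaxial rings with swirl (time `t = 1` only) -/

/-- Static ring data at the initial time: `n` coaxial rings with signed circulations `Γ i`, radii `R i`, heights `Z i`,
Gaussian core radii `a i`, peak swirl speeds `s i`, and the cut-off radius `ρ₀`. (No trajectories: v5 prescribes NOTHING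
after `t = 1` — the free run does.) -/
structure RingDatum where
  /-- number of rings -/
  n : ℕ
  /-- signed circulation of ring `i` -/
  Γ : Fin n → ℝ
  /-- ring radius -/
  R : Fin n → ℝ
  /-- ring height (axial position) -/
  Z : Fin n → ℝ
  /-- Gaussian core radius -/
  a : Fin n → ℝ
  /-- peak azimuthal (swirl) speed of ring `i` -/
  s : Fin n → ℝ
  /-- cut-off radius (the datum is supported in `‖x‖ ≤ ρ₀`) -/
  ρ₀ : ℝ

/-- Squared distance to the symmetry (`x₃`-)axis, `ϖ² = y₀² + y₁²`. -/
def cylSq (y : EuclideanSpace ℝ (Fin 3)) : ℝ := y 0 ^ 2 + y 1 ^ 2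

/-- `ϖ · e_θ = (−y₁, y₀, 0)`. -/
def azim (y : EuclideanSpace ℝ (Fin 3)) : EuclideanSpace ℝ (Fin 3) :=
  y 0 • EuclideanSpace.single 1 (1 : ℝ) - y 1 • EuclideanSpace.single 0 (1 : ℝ)

/-- The axial unit vector `e₃`. -/
def e3 : EuclideanSpace ℝ (Fin 3) := EuclideanSpace.single 2 (1 : ℝ)

/-- Gaussian ring profile of ring `i` in the variables `(q, ζ) = (ϖ², y₂)`:
`exp(−(q − R²)²/(4R²a²) − (ζ − Z)²/a²)` (width `a` around the circle `ϖ = R`, `y₂ = Z`; smooth, polynomial in `ϖ²`). -/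
def gaussQ (d : RingDatum) (i : Fin d.n) (q ζ : ℝ) : ℝ :=
  Real.exp (-((q - d.R i ^ 2) ^ 2 / (4 * d.R i ^ 2 * d.a i ^ 2)) - (ζ - d.Z i) ^ 2 / d.a i ^ 2)

/-- Reference azimuthal vorticity `Σ_i Γ_i/(π a_i² R_i) · gauss_i · (ϖ e_θ)` (circulation `≈ Γ_i` on core `i`). -/
def ωD (d : RingDatum) (y : EuclideanSpace ℝ (Fin 3)) : EuclideanSpace ℝ (Fin 3) :=
  ∑ i : Fin d.n, (d.Γ i / (Real.pi * d.a i ^ 2 * d.R i) * gaussQ d i (cylSq y) (y 2)) • azim y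

/-- Newtonian vector potential `(1/4π) ∫ ζ(y)/‖x − y‖ dy` (its curl is the Biot–Savart velocity of a divergence-free `ζ`). -/
def newtonPot (ζ : EuclideanSpace ℝ (Fin 3) → EuclideanSpace ℝ (Fin 3)) (x : EuclideanSpace ℝ (Fin 3)) :
    EuclideanSpace ℝ (Fin 3) :=
  (1 / (4 * Real.pi)) • ∫ y, (‖x - y‖)⁻¹ • ζ y

/-- Swirl potential `F(ϖ², y₂) e₃` with `F(q, ζ) = Σ_i s_i/(2R_i) ∫_q^∞ gauss_i(q′, ζ) dq′`; its curl is the azimuthal swirl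
field `ϖ Σ_i (s_i/R_i) gauss_i e_θ` (peak `≈ s_i` on core `i`), up to orientation. -/
def swirlPot (d : RingDatum) (y : EuclideanSpace ℝ (Fin 3)) : EuclideanSpace ℝ (Fin 3) :=
  (∑ i : Fin d.n, d.s i / (2 * d.R i) * ∫ q in Set.Ioi (cylSq y), gaussQ d i q (y 2)) • e3

/-- Radial smooth cut-off: `= 1` for `‖x‖ ≤ ρ₀/√2`, `= 0` for `‖x‖ ≥ ρ₀` (`Real.smoothTransition`). -/
def cutoff (d : RingDatum) (x : EuclideanSpace ℝ (Fin 3)) : ℝ :=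
  Real.smoothTransition (2 - 2 * ‖x‖ ^ 2 / d.ρ₀ ^ 2)

/-- THE EXPLICIT COMPACTLY SUPPORTED POTENTIAL: cut-off · (Newtonian potential of the ring vorticity + swirl potential). -/
def potD (d : RingDatum) (x : EuclideanSpace ℝ (Fin 3)) : EuclideanSpace ℝ (Fin 3) :=
  cutoff d x • (newtonPot (ωD d) x + swirlPot d x)

/-- THE REGIME (explicit numerals): at least one ring, `ρ₀ > 0`; positive cores with `a_i ≤ R_i/20`; every ring inside
`‖x‖ ≤ ρ₀/4` with ten core radii to spare (so the cut-off is `1` on and around the cores); pairwise meridional core separation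
`≥ 2(a_i + a_j)`; and a SWIRL FLOOR on some ring with nonzero circulation, `|s_i| ≥ |Γ_i|/(40π a_i)` (5 % of the core-edge
speed) — the class is NOT the sterile swirl-free one. -/
def RegimeD (d : RingDatum) : Prop :=
  1 ≤ d.n ∧ 0 < d.ρ₀ ∧
  (∀ i : Fin d.n, 0 < d.a i ∧ d.a i ≤ d.R i / 20 ∧ d.R i + |d.Z i| + 10 * d.a i ≤ d.ρ₀ / 4 ∧
      ∀ j : Fin d.n, j ≠ i → 2 * (d.a i + d.a j) ≤ Real.sqrt ((d.R i - d.R j) ^ 2 + (d.Z i - d.Z j) ^ 2)) ∧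
  (∃ i : Fin d.n, d.Γ i ≠ 0 ∧ |d.Γ i| / (40 * Real.pi * d.a i) ≤ |d.s i|)

/-! ## §1b Proved static facts about the cut-off (no sorry): the support clause of stub A and smoothness of `cutoff` -/

/-- The cut-off is smooth. -/
theorem cutoff_contDiff (d : RingDatum) : ContDiff ℝ ∞ (cutoff d) := by
  have h : ContDiff ℝ ∞ (fun x : EuclideanSpace ℝ (Fin 3) => 2 - 2 * ‖x‖ ^ 2 / d.ρ₀ ^ 2) :=
    contDiff_const.sub ((contDiff_const.mul (contDiff_norm_sq ℝ)).div_const _)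
  exact Real.smoothTransition.contDiff.comp h

/-- The cut-off vanishes outside the ball of radius `ρ₀` (for `ρ₀ > 0`). -/
theorem cutoff_eq_zero_of_le (d : RingDatum) (hρ : 0 < d.ρ₀) {x : EuclideanSpace ℝ (Fin 3)} (hx : d.ρ₀ ≤ ‖x‖) :
    cutoff d x = 0 := by
  unfold cutoff
  apply Real.smoothTransition.zero_of_nonpos
  have hx2 : d.ρ₀ ^ 2 ≤ ‖x‖ ^ 2 := pow_le_pow_left₀ hρ.le hx 2
  have hρ2 : 0 < d.ρ₀ ^ 2 := by positivity
  rw [sub_nonpos, le_div_iff₀ hρ2]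
  linarith

/-- **Support clause of stub A, proved:** `tsupport (potD d) ⊆ B̄(0, ρ₀)` whenever `ρ₀ > 0` (in particular in the regime). -/
theorem potD_tsupport_subset (d : RingDatum) (hρ : 0 < d.ρ₀) :
    tsupport (potD d) ⊆ closedBall (0 : EuclideanSpace ℝ (Fin 3)) d.ρ₀ := by
  refine closure_minimal (fun x hx => ?_) isClosed_closedBall
  rw [mem_closedBall, dist_zero_right]
  by_contra h
  push_neg at h
  apply hx
  show potD d x = 0
  simp only [potD, cutoff_eq_zero_of_le d hρ h.le, zero_smul]

/-- The support clause in the regime. -/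
theorem potD_tsupport_subset_of_regime (d : RingDatum) (hd : RegimeD d) :
    tsupport (potD d) ⊆ closedBall (0 : EuclideanSpace ℝ (Fin 3)) d.ρ₀ :=
  potD_tsupport_subset d hd.2.1

/-! ## §2 The two stubs and the composition -/

/-- **STUB A — STATIC DATUM LEMMA (analysis, M/L; provable: smoothness of the Newtonian potential of a Schwartz field,
the cut-off, rotation-equivariance, linear independence of distinct Gaussians for the swirl).** For every ring datum in the
regime the potential `potD d` is `C^∞` with `tsupport ⊆ B̄(0, ρ₀)`, and the datum `curl (potD d)` is axisymmetric WITH swirl.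
Why it might fail: only by a typing slip (e.g. smoothness of `x ↦ ∫ ζ(y)/‖x−y‖ dy` needs the decay that `gaussQ` provides; the
swirl conclusion needs the floor ring's Gaussian not to be cancelled identically — distinct centres by the separation clause). -/
def DatumStaticT : Prop :=
  ∀ d : RingDatum, RegimeD d →
    ContDiff ℝ ∞ (potD d) ∧ tsupport (potD d) ⊆ closedBall 0 d.ρ₀ ∧
    IsAxisymmetric (curl (potD d)) ∧ ¬ HasNoSwirl (curl (potD d))

/-- **STUB B — ONE FREE RUN SHOWS THE TUNED FACES (the decider; XL as a kernel certificate, cheap to PROBE by DNS = R19).**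
Some ring datum `d` in the regime has datum speed `< Y₀`, and the free Navier–Stokes run (`ν = 1`, zero force) from
`curl (potD d)` exists classically with finite energy on `[1, τ₁]`, stays under the cap `(5/3)Y₁ − η` and shows, at `τ₁` inside
`‖x‖ ≤ ρ₀`, speed `≥ Y₁ + η`, gradient `≥ A₁ + η` and an `N₁`-core loop of circulation `≥ N₁^{β−2} + η` for some `η > 0` —
verbatim the dynamic binders of `Theorems.palasekTowerBreakdown_episodeBaseT_of_mechanism_freeRun`. Candidate of record: the
R18 design point PX-R30-sw0.45 at `t′ = 0` (faces met by the reference kinematics with slack 0.10, speed margin +0.040).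
Why it might fail: (i) thin speed margin vs true (non-fiat) core dynamics; (ii) centrifugal instability of compactly supported
swirl over 169.85 strain times; (iii) certificate size (dissipativity-aware enclosure needed). -/
def FreeRunFacesT : Prop :=
  ∃ d : RingDatum, RegimeD d ∧ (∀ x, ‖curl (potD d) x‖ < Y0) ∧
    ∃ (v : ℝ → EuclideanSpace ℝ (Fin 3) → EuclideanSpace ℝ (Fin 3)) (q : ℝ → EuclideanSpace ℝ (Fin 3) → ℝ) (η : ℝ),
      IsClassicalNSSolutionOn (Icc 1 (Host.τfirstAt TowerRates.tuned)) 1 0 v q ∧ v 1 = curl (potD d) ∧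
      (∃ C : ℝ≥0∞, C < ⊤ ∧ ∀ t ∈ Icc (1 : ℝ) (Host.τfirstAt TowerRates.tuned), ∫⁻ x, ‖v t x‖ₑ ^ 2 ≤ C) ∧
      0 < η ∧
      (∀ t ∈ Icc (1 : ℝ) (Host.τfirstAt TowerRates.tuned), ∀ x, ‖v t x‖ ≤ 5 / 3 * TowerRates.tuned.Y 1 - η) ∧
      (∃ x, ‖x‖ ≤ d.ρ₀ ∧ TowerRates.tuned.Y 1 + η ≤ ‖v (Host.τfirstAt TowerRates.tuned) x‖) ∧
      (∃ x, ‖x‖ ≤ d.ρ₀ ∧ TowerRates.tuned.A 1 + η ≤ ‖fderiv ℝ (v (Host.τfirstAt TowerRates.tuned)) x‖) ∧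
      (∃ (x : EuclideanSpace ℝ (Fin 3)) (γ : ℝ → EuclideanSpace ℝ (Fin 3)),
        ‖x‖ ≤ d.ρ₀ ∧ ContDiff ℝ 1 γ ∧ γ 0 = γ 1 ∧
        (∀ s ∈ Icc (0 : ℝ) 1, γ s ∈ closedBall x (1 / TowerRates.tuned.N 1)) ∧
        (∀ s ∈ Icc (0 : ℝ) 1, ‖deriv γ s‖ ≤ 8 * Real.pi / TowerRates.tuned.N 1) ∧
        TowerRates.tuned.N 1 ^ (TowerRates.tuned.β - 2) + η ≤
          circulation (v (Host.τfirstAt TowerRates.tuned)) γ)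

/-- Stub A (static datum lemma). -/
theorem stub_datumStaticT : DatumStaticT := by
  sorry

/-- What remains of stub A after §1b: smoothness of the potential, axisymmetry and swirl of its curl (the support clause is proved). -/
def DatumStaticCoreT : Prop :=
  ∀ d : RingDatum, RegimeD d →
    ContDiff ℝ ∞ (potD d) ∧ IsAxisymmetric (curl (potD d)) ∧ ¬ HasNoSwirl (curl (potD d))

/-- Stub A follows from its core and the proved support clause `potD_tsupport_subset_of_regime` (no sorry). -/
theorem datumStaticT_of_core (h : DatumStaticCoreT) : DatumStaticT := fun d hd =>
  ⟨(h d hd).1, potD_tsupport_subset_of_regime d hd, (h d hd).2.1, (h d hd).2.2⟩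

/-- Stub B (one free run shows the tuned faces). -/
theorem stub_freeRunFacesT : FreeRunFacesT := by
  sorry

/-- **THE CRUX OF RECORD FROM THE TWO STUBS (sorry-free composition): static datum lemma ⊕ one free run with faces ⟹
`EpisodeBaseT` BY NAME**, through the landed binder-form door `Theorems.palasekTowerBreakdown_episodeBaseT_of_mechanism_freeRun`
applied to `W := curl (potD d)`; the static binders (smooth, divergence-free, compact support) are discharged from stub A by
`Germ.contDiff_curl_top`, `Germ.isDivFree_curl`, `Germ.tsupport_curl_subset`; axisymmetry-with-swirl is unused by 20303 itself —
it pins the witness class outside the sterile stratum. [cite: Palasek2026ElementaryModel, §4] -/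
theorem episodeBaseT_from_line : PalasekTowerBreakdown.EpisodeBaseT := by
  obtain ⟨d, hd, hlt, v, q, η, hv, hv1, hE, hη, hcap, hspeed, hstrain, hcore⟩ := stub_freeRunFacesT
  obtain ⟨hA, hsupp, -, -⟩ := stub_datumStaticT d hd
  exact Theorems.palasekTowerBreakdown_episodeBaseT_of_mechanism_freeRun (Germ.contDiff_curl_top hA)
    (Germ.isDivFree_curl hA) (Germ.tsupport_curl_subset hsupp) hlt hd.2.1.le hv hv1 hE hη hcap hspeed hstrain hcore

/-- The composition as an implication between the stub statements (what a reader checks first). -/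
theorem episodeBaseT_of (hA : DatumStaticT) (hB : FreeRunFacesT) : PalasekTowerBreakdown.EpisodeBaseT := by
  obtain ⟨d, hd, hlt, v, q, η, hv, hv1, hE, hη, hcap, hspeed, hstrain, hcore⟩ := hB
  obtain ⟨hA', hsupp, -, -⟩ := hA d hd
  exact Theorems.palasekTowerBreakdown_episodeBaseT_of_mechanism_freeRun (Germ.contDiff_curl_top hA')
    (Germ.isDivFree_curl hA') (Germ.tsupport_curl_subset hsupp) hlt hd.2.1.le hv hv1 hE hη hcap hspeed hstrain hcore

end Summit.NavierStokesRegularity.NavierStokesRegularity.Cruxes.EpisodeBaseT.FreeRunFaces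

end
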